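import Literature.AnabelianGeometry.EtaleTheta.Discharge.Sec2AutOverGammaStructure
import Literature.AnabelianGeometry.EtaleTheta.Discharge.Sec2Cor218ivOfSetting
import Literature.AnabelianGeometry.EtaleTheta.Discharge.Sec2Cor218iThetaSubquotients
import HarnessLib

/-!
# [EtTh] Cor 2.18 (iv), surjectivity (`RigidData.Cor218_iv_surjective`, FROZEN FACT-LIST row F-0625):
# what the row FORCES for every `R : RigidData N l`, and the row from the `L`-free core of Cor 2.18 (i)
# (proof-only companion)

Mochizuki, *The Étale Theta Function and its Frobenioid-theoretic Manifestations* [EtTh], Publ. RIMS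
45 (2009), §2: Cor 2.18 (i) p.60, (ii) p.60, (iv) pp.61–63 ("The surjectivity of the homomorphism of
(iv) follows by applying the 'functorial group-theoretic algorithm' of (ii), in light of the final
portion of (iii)"), Cor 2.19 (iii) p.64 (locators `p.N` = PDF pages of the PRIMS text; bib key
`MochizukiEtTh2009`). PROOF-ONLY companion (no `def`, no instance, no new named fact) of
`ThetaRigidity.lean` (seat abc-iut-L2-t2; DEFS-FREEZE respected: imported, never edited); cell abc-iut,
block F, seat abc-iut-f-147 (gen 3), F-TRANCHES tranche 147 (F-0623 · F-0624 · F-0625 · F-0626).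

STATE OF RECORD for F-0625. A SCHEMA over the lawless interface `RigidData N l`: its universal closure
is REFUTED at a toy (abc-iut-w5-d175, `RigidData.Toy.not_forall_cor218_iv_surjective`,
`ThetaRigiditySchemaWitness.lean`), so the row is consumable at a named instance only; the route of
record (abc-iut-L2-t10 `RigidData.cor218_iv_surjective_of`, lane C2
`DoubleUnderline.rigidData_cor218_iv_surjective`) derives it from Cor 2.18 (i) (`Cor218_i` = the
anabelian input, ALL six clauses including the cusp LABELS), Cor 2.18 (ii) and constant multiple
rigidity `hcoll`. abc-iut-f-148 (`Sec2Cor218iCoreClauses.lean`) proved that the LABEL clause of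
`Cor218_i` is unsatisfiable at some labelling of the §1 adapter whenever `Π^tp_X` is temp-slim
(`not_forall_cuspLabels_cor218_i_of_slim`) — a binder `h218i : R.Cor218_i` at an arbitrary labelling is
vacuous there — and re-threaded Cor 2.19 (i) on the `L`-free core; Cor 2.18 (iv) had no such twin.

THIS FILE.
* §1 NECESSITY (every `R`; no hypothesis beyond the row — `thetaCocycles` is nonempty by the interface):
  `map_PiYdd_eq_of_cor218_iv_surjective` — **the row forces `γ(Π^tp_Ÿ) = Π^tp_Ÿ`** for every
  `Π^tp_Y`-preserving automorphism `γ` of the topological group `Π^tp_X` (the `Π^tp_Ÿ`-clause of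
  Cor 2.18 (i) at such `γ`); `chi_aug_invariant_PiY_of_cor218_iv_surjective` — **it forces
  `χ ∘ aug ∘ γ = χ ∘ aug` on `Π^tp_Y`**; `exists_cocycle_of_cor218_iv_surjective` — **it forces
  `ψ ∘ η = (η · φ) ∘ γ` on `Π^tp_Ÿ`** for some `ψ ∈ Aut(μ_N)` and a continuous `Π^tp_Y`-cocycle `φ`
  (constant multiple rigidity up to a `Π^tp_Y`-cocycle; `hcoll` is the inflated-from-`G_K` case);
  `necessary_of_cor218_iv_surjective` (the three together). Engine: `Sec2AutOverGammaStructure.lean`.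
* §2 SUFFICIENCY FROM THE `L`-FREE CORE: `cor218_iv_surjective_of_core` — the row from `Cor218_ii`,
  `hcoll` and the FOUR label-free clauses `Π^tp_Ÿ`, `Δ_X`, `Ker(Π^tp_X ↠ (Π^tp_X)^Θ)`, `l·Δ_Θ` of
  `Cor218_i`, at `Π^tp_Y`-preserving `γ` only (abc-iut-L2-t2's per-automorphism
  `exists_monoIso_over_aut_of_cor218_ii`); `cor218_iv_surjective_of_core'` (with `χ`-invariance in
  place of the two theta subquotients); `core4_of_cor218_i` (the core from the full row F-0620).
* §3 AT abc-iut-L2-t8's §1 → §2 ADAPTER `C.rigidData`: `rigidData_cor218_iv_surjective_of_core` (lane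
  C2's theorem with the label-free binder), `rigidData_cor218_iv_surjective_of_extends` (the core from
  "every `γ ∈ Aut_top(Π^tp_X̲̲)` extends to a `Δ^tp_X`- and `Π^tp_Ÿ`-stabilising `Γ ∈ Aut_top(Π^tp_X)`",
  abc-iut-L2-d1's `rigidData_cor218_i_of_extends` WITHOUT its label hypothesis `hcusp`), and the
  necessity read at the adapter (`rigidData_necessary_of_cor218_iv_surjective`).

GAP between §1 and §2 (stated, not hidden): necessity yields `Π^tp_Ÿ`- and `χ`-preservation on
`Π^tp_Y` and a `Π^tp_Y`-cocycle `φ`; sufficiency consumes in addition `Δ_X`-preservation (used only to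
normalise `D_Y`), `φ` inflated from `G_K`, and `Cor218_ii`. HONEST FRAMING: kernel-checked
implications over the typed interface; the anabelian input (F-0620) and constant multiple rigidity are
NOT claimed; nothing of [EtTh] (refereed) is asserted or disputed; no side is taken on [IUTchIII]
Cor 3.12; typed ≠ proved; a FACT row is an assumption label, not an endorsement.
-/

noncomputable section

namespace Literature.AnabelianGeometry.EtaleTheta

universe u

namespace RigidData

variable {N : ℕ+} {l : ℕ} (R : RigidData.{u} N l)

/-! ## §1. What `Cor218_iv_surjective` (F-0625) FORCES, for every `R : RigidData N l` -/

/-- If `γ` maps a subgroup onto itself, so does `γ⁻¹`. [cite: MochizukiEtTh2009, Cor 2.18(i) p.60] -/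
theorem map_symm_eq_self_of_map_eq_self (γ : R.PiX ≃ₜ* R.PiX) (H : Subgroup R.PiX)
    (hH : H.map γ.toMulEquiv.toMonoidHom = H) :
    H.map γ.symm.toMulEquiv.toMonoidHom = H := by
  obtain ⟨h1, h2⟩ := R.toThetaEnvData.mem_and_symm_mem_of_map_eq γ H hH
  ext x
  constructor
  · rintro ⟨y, hy, rfl⟩
    exact h2 y hy
  · intro hx
    exact ⟨γ x, h1 x hx, γ.symm_apply_apply x⟩

/-- **F-0625 forces the `Π^tp_Ÿ`-clause of Cor 2.18 (i)** (for every `R : RigidData N l`): if every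
`Π^tp_Y`-preserving automorphism `γ` of `Π^tp_X` lifts to the model mono-theta environment, then every
such `γ` maps `Π^tp_Ÿ` ONTO itself. [cite: MochizukiEtTh2009, Cor 2.18(iv) p.61] -/
theorem map_PiYdd_eq_of_cor218_iv_surjective (h : R.Cor218_iv_surjective) (γ : R.PiX ≃ₜ* R.PiX)
    (hγ : R.PiY.map γ.toMulEquiv.toMonoidHom = R.PiY) :
    R.PiYdd.map γ.toMulEquiv.toMonoidHom = R.PiYdd := by
  obtain ⟨η, hη⟩ := R.thetaCocycles_nonempty
  obtain ⟨α, hα⟩ := h η hη γ hγ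
  obtain ⟨β, hβ⟩ := h η hη γ.symm (R.map_symm_eq_self_of_map_eq_self γ _ hγ)
  have h1 := R.toThetaEnvData.apply_mem_PiYdd_of_iso_over hη α hα
  have h2 := R.toThetaEnvData.apply_mem_PiYdd_of_iso_over hη β hβ
  ext x
  constructor
  · rintro ⟨d, hd, rfl⟩
    exact h1 ⟨d, hd⟩
  · intro hx
    exact ⟨γ.symm x, h2 ⟨x, hx⟩, γ.apply_symm_apply x⟩

/-- **F-0625 forces the `γ`-invariance of the cyclotomic character on `Π^tp_Y`**: `χ(aug(γ g)) = χ(aug g)`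
for every `Π^tp_Y`-preserving `γ` and `g ∈ Π^tp_Y` (the hypothesis `hχ` of the route of record, restricted
to `Π^tp_Y`, is NECESSARY). [cite: MochizukiEtTh2009, Cor 2.18(iv) p.61] -/
theorem chi_aug_invariant_PiY_of_cor218_iv_surjective (h : R.Cor218_iv_surjective)
    (γ : R.PiX ≃ₜ* R.PiX) (hγ : R.PiY.map γ.toMulEquiv.toMonoidHom = R.PiY) (g : R.PiY) :
    R.chi (R.aug (γ (g : R.PiX))) = R.chi (R.aug (g : R.PiX)) := by
  obtain ⟨η, hη⟩ := R.thetaCocycles_nonempty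
  obtain ⟨α, hα⟩ := h η hη γ hγ
  exact R.toThetaEnvData.chi_aug_apply_eq_of_over (α := α.e.toMulEquiv) hα g

/-- **F-0625 forces constant-multiple rigidity up to a `Π^tp_Y`-cocycle**: for every theta cocycle `η`
and every `Π^tp_Y`-preserving `γ` there are `ψ ∈ Aut(μ_N)` and a continuous cocycle `φ` of `Π^tp_Y` (its
shift an automorphism of the topological group `Π^tp_Y[μ_N]`) with `ψ(η d) = η(d′) · φ(d′)` whenever
`γ d = d′`. The route of record assumes this with `φ` inflated from `G_K` (`hcoll`).
[cite: MochizukiEtTh2009, Cor 2.19(iii) p.64] -/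
theorem exists_cocycle_of_cor218_iv_surjective (h : R.Cor218_iv_surjective)
    {η : R.PiYdd → R.mu} (hη : η ∈ R.thetaCocycles)
    (γ : R.PiX ≃ₜ* R.PiX) (hγ : R.PiY.map γ.toMulEquiv.toMonoidHom = R.PiY) :
    ∃ (ψ : R.mu ≃* R.mu) (φ : R.PiY → R.mu) (hφ : CycEnvelope.IsEnvCocycle R.augY R.chi φ),
      Continuous φ ∧ CycEnvelope.shift hφ ∈ contMulAut R.env ∧
      ∀ d d' : R.PiYdd, γ (d : R.PiX) = d' → ψ (η d) = η d' * φ (R.inclYdd d') := by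
  obtain ⟨α, hα⟩ := h η hη γ hγ
  obtain ⟨ψ, φ, hφ, hc, hs, -, hmain⟩ := R.toThetaEnvData.exists_cocycle_of_iso_over hη α hγ hα
  exact ⟨ψ, φ, hφ, hc, hs, hmain⟩

/-- **The necessary conditions together**: `Cor218_iv_surjective` implies, for every `Π^tp_Y`-preserving
automorphism `γ` of the topological group `Π^tp_X`: `γ(Π^tp_Ÿ) = Π^tp_Ÿ`, `χ ∘ aug ∘ γ = χ ∘ aug` on
`Π^tp_Y`, and the theta collection is `γ`-stable up to a coefficient automorphism and a `Π^tp_Y`-cocycle.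
[cite: MochizukiEtTh2009, Cor 2.18(iv) p.61] -/
theorem necessary_of_cor218_iv_surjective (h : R.Cor218_iv_surjective) (γ : R.PiX ≃ₜ* R.PiX)
    (hγ : R.PiY.map γ.toMulEquiv.toMonoidHom = R.PiY) :
    R.PiYdd.map γ.toMulEquiv.toMonoidHom = R.PiYdd ∧
      (∀ g : R.PiY, R.chi (R.aug (γ (g : R.PiX))) = R.chi (R.aug (g : R.PiX))) ∧
      ∀ (η : R.PiYdd → R.mu), η ∈ R.thetaCocycles →
        ∃ (ψ : R.mu ≃* R.mu) (φ : R.PiY → R.mu) (hφ : CycEnvelope.IsEnvCocycle R.augY R.chi φ),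
          Continuous φ ∧ CycEnvelope.shift hφ ∈ contMulAut R.env ∧
          ∀ d d' : R.PiYdd, γ (d : R.PiX) = d' → ψ (η d) = η d' * φ (R.inclYdd d') :=
  ⟨R.map_PiYdd_eq_of_cor218_iv_surjective h γ hγ, R.chi_aug_invariant_PiY_of_cor218_iv_surjective h γ hγ,
    fun _ hη => R.exists_cocycle_of_cor218_iv_surjective h hη γ hγ⟩

/-! ## §2. F-0625 from the `L`-free core of Cor 2.18 (i) (sufficiency, label-free) -/

/-- **Cor 2.18 (iv), surjectivity, FROM THE `L`-FREE CORE of Cor 2.18 (i)**: if every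
`Π^tp_Y`-preserving automorphism `γ` of the topological group `Π^tp_X` preserves `Π^tp_Ÿ`, `Δ_X`,
`Ker(Π^tp_X ↠ (Π^tp_X)^Θ)` and `l·Δ_Θ` (four clauses of `Cor218_i`, at such `γ` only — the `Π^tp_Y`-clause
is the hypothesis of the row and the cusp-LABEL clause is NOT used), the models are isomorphic over the
identity (`Cor218_ii`) and the theta collection is `γ`-stable up to coefficients and a Kummer twist
(`hcoll`, constant multiple rigidity), then `Cor218_iv_surjective` holds — abc-iut-L2-t10's
`cor218_iv_surjective_of` through abc-iut-L2-t2's per-automorphism `exists_monoIso_over_aut_of_cor218_ii`.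
[cite: MochizukiEtTh2009, Cor 2.18(iv) p.61] -/
theorem cor218_iv_surjective_of_core (h218ii : R.Cor218_ii)
    (hcore : ∀ γ : R.PiX ≃ₜ* R.PiX, R.PiY.map γ.toMulEquiv.toMonoidHom = R.PiY →
      R.PiYdd.map γ.toMulEquiv.toMonoidHom = R.PiYdd ∧
      R.aug.ker.map γ.toMulEquiv.toMonoidHom = R.aug.ker ∧
      R.thetaKer.map γ.toMulEquiv.toMonoidHom = R.thetaKer ∧
      R.lDeltaTheta.map γ.toMulEquiv.toMonoidHom = R.lDeltaTheta)
    (hcoll : ∀ γ : R.PiX ≃ₜ* R.PiX, R.PiY.map γ.toMulEquiv.toMonoidHom = R.PiY →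
      ∃ ψ : R.mu ≃* R.mu, ∀ (η : R.PiYdd → R.mu), η ∈ R.thetaCocycles →
        ∃ (η'' : R.PiYdd → R.mu) (_ : η'' ∈ R.thetaCocycles) (c : R.G → R.mu)
          (hc : CycEnvelope.IsEnvCocycle R.augY R.chi (c ∘ R.augY))
          (_ : CycEnvelope.shift hc ∈ contMulAut R.env),
          ∀ d d' : R.PiYdd, γ (d : R.PiX) = d' → ψ (η d) = η'' d' * c (R.augY (R.inclYdd d'))) :
    R.Cor218_iv_surjective := by
  intro η hη γ hγ
  obtain ⟨hdd, hker, hK, hL⟩ := hcore γ hγ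
  obtain ⟨ψ, hψ⟩ := hcoll γ hγ
  obtain ⟨η'', hη'', c, hc, hcc, hηc⟩ := hψ η hη
  exact R.exists_monoIso_over_aut_of_cor218_ii h218ii hη γ hγ hdd hker hK hL ψ hη'' c hc hcc hηc

/-- **Variant with the cyclotomic character in place of the theta subquotients**: `Π^tp_Ÿ`, `Δ_X`
preserved and `χ ∘ aug ∘ γ = χ ∘ aug` (the latter two only enter the `D_Y`-normalisation), plus
`Cor218_ii` and `hcoll`. [cite: MochizukiEtTh2009, Cor 2.18(iv) p.61] -/
theorem cor218_iv_surjective_of_core' (h218ii : R.Cor218_ii)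
    (hcore : ∀ γ : R.PiX ≃ₜ* R.PiX, R.PiY.map γ.toMulEquiv.toMonoidHom = R.PiY →
      R.PiYdd.map γ.toMulEquiv.toMonoidHom = R.PiYdd ∧
      R.aug.ker.map γ.toMulEquiv.toMonoidHom = R.aug.ker ∧
      ∀ x : R.PiX, R.chi (R.aug (γ x)) = R.chi (R.aug x))
    (hcoll : ∀ γ : R.PiX ≃ₜ* R.PiX, R.PiY.map γ.toMulEquiv.toMonoidHom = R.PiY →
      ∃ ψ : R.mu ≃* R.mu, ∀ (η : R.PiYdd → R.mu), η ∈ R.thetaCocycles →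
        ∃ (η'' : R.PiYdd → R.mu) (_ : η'' ∈ R.thetaCocycles) (c : R.G → R.mu)
          (hc : CycEnvelope.IsEnvCocycle R.augY R.chi (c ∘ R.augY))
          (_ : CycEnvelope.shift hc ∈ contMulAut R.env),
          ∀ d d' : R.PiYdd, γ (d : R.PiX) = d' → ψ (η d) = η'' d' * c (R.augY (R.inclYdd d'))) :
    R.Cor218_iv_surjective := by
  intro η hη γ hγ
  obtain ⟨hdd, hker, hχ⟩ := hcore γ hγ
  obtain ⟨ψ, hψ⟩ := hcoll γ hγ
  obtain ⟨η'', hη'', c, hc, hcc, hηc⟩ := hψ η hη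
  obtain ⟨e, he⟩ := h218ii η'' η hη'' hη
  exact R.toThetaEnvData.exists_monoIso_over_aut hη γ hγ hdd hker hχ ψ hη'' c hc hcc hηc e he

/-- The `L`-free core follows from the full `Cor218_i` (projection to clauses 2–5 of 6), so
`cor218_iv_surjective_of_core` recovers the route of record `cor218_iv_surjective_of_cor218_i_ii`.
[cite: MochizukiEtTh2009, Cor 2.18(i) p.60] -/
theorem core4_of_cor218_i (h : R.Cor218_i) (γ : R.PiX ≃ₜ* R.PiX) :
    R.PiYdd.map γ.toMulEquiv.toMonoidHom = R.PiYdd ∧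
      R.aug.ker.map γ.toMulEquiv.toMonoidHom = R.aug.ker ∧
      R.thetaKer.map γ.toMulEquiv.toMonoidHom = R.thetaKer ∧
      R.lDeltaTheta.map γ.toMulEquiv.toMonoidHom = R.lDeltaTheta :=
  let ⟨_, hdd, hΔ, hK, hL, _⟩ := h γ
  ⟨hdd, hΔ, hK, hL⟩

end RigidData

/-! ## §3. At abc-iut-L2-t8's §1 → §2 adapter `C.rigidData`: the row with a LABEL-FREE binder -/

namespace ThetaSetting.EtaleThetaData.DoubleUnderline

variable {p : ℕ} [Fact p.Prime] {D : ThetaSetting p} {E : D.EtaleThetaData} {l : ℕ}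
  (C : E.DoubleUnderline l) {Es : Set ℕ+} (τ : D.CyclotomeTower l Es)

/-- **[EtTh] Cor 2.18 (iv), surjectivity, for the §1 model at a tower level, with the `L`-free core as
binder** — lane C2's `rigidData_cor218_iv_surjective` with `h218i : R.Cor218_i` (unsatisfiable at some
labelling `L` whenever `Π^tp_X` is temp-slim, abc-iut-f-148's `not_forall_cuspLabels_cor218_i_of_slim`)
replaced by the four label-free clauses at `Π^tp_Y̲̲`-preserving `γ`; conditional, as there, on Prop 1.5
(ii), (iii) (through `rigidData_cor218_ii`) and constant multiple rigidity `hcoll`.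
[cite: MochizukiEtTh2009, Cor 2.18(iv) p.61] -/
theorem rigidData_cor218_iv_surjective_of_core (M : Es) (hC : D.Compat) (hS : D.Sec2Hyps)
    (h15 : Prop15iii E hC) (h15ii : Prop15ii E.toKummerData hC) (L : C.CuspLabels)
    (R : RigidData.{0} M l) (hR : R = C.rigidData (τ.mod M) hC hS h15 L)
    (hcore : ∀ γ : R.PiX ≃ₜ* R.PiX, R.PiY.map γ.toMulEquiv.toMonoidHom = R.PiY →
      R.PiYdd.map γ.toMulEquiv.toMonoidHom = R.PiYdd ∧
      R.aug.ker.map γ.toMulEquiv.toMonoidHom = R.aug.ker ∧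
      R.thetaKer.map γ.toMulEquiv.toMonoidHom = R.thetaKer ∧
      R.lDeltaTheta.map γ.toMulEquiv.toMonoidHom = R.lDeltaTheta)
    (hcoll : ∀ γ : R.PiX ≃ₜ* R.PiX, R.PiY.map γ.toMulEquiv.toMonoidHom = R.PiY →
      ∃ ψ : R.mu ≃* R.mu, ∀ (η : R.PiYdd → R.mu), η ∈ R.thetaCocycles →
        ∃ (η'' : R.PiYdd → R.mu) (_ : η'' ∈ R.thetaCocycles) (c : R.G → R.mu)
          (hc : CycEnvelope.IsEnvCocycle R.augY R.chi (c ∘ R.augY))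
          (_ : CycEnvelope.shift hc ∈ contMulAut R.env),
          ∀ d d' : R.PiYdd, γ (d : R.PiX) = d' → ψ (η d) = η'' d' * c (R.augY (R.inclYdd d'))) :
    R.Cor218_iv_surjective := by
  subst hR
  exact RigidData.cor218_iv_surjective_of_core _ (C.rigidData_cor218_ii τ M hC hS h15 h15ii L) hcore hcoll

/-- **The same with the core supplied by EXTENSION**: if every automorphism `γ` of the topological group
`Π^tp_X̲̲` extends to an automorphism `Γ` of `Π^tp_X` stabilising `Δ^tp_X` and `Π^tp_Ÿ` (abc-iut-L2-d1's
`rigidData_cor218_i_of_extends` WITHOUT its cusp-label hypothesis `hcusp`), then Cor 2.18 (iv),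
surjectivity, holds for the §1 model at the tower level `M`, conditional on Prop 1.5 (ii), (iii) and
`hcoll`. [cite: MochizukiEtTh2009, Cor 2.18(iv) p.61] -/
theorem rigidData_cor218_iv_surjective_of_extends (M : Es) (hC : D.Compat) (hS : D.Sec2Hyps)
    (h15 : Prop15iii E hC) (h15ii : Prop15ii E.toKummerData hC) (L : C.CuspLabels)
    (hext : ∀ γ : ↥C.Huu ≃ₜ* ↥C.Huu, ∃ Γ : D.PiTemp ≃ₜ* D.PiTemp,
      (∀ h : C.Huu, Γ (h : D.PiTemp) = ((γ h : C.Huu) : D.PiTemp)) ∧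
      D.DeltaTemp.map Γ.toMulEquiv.toMonoidHom = D.DeltaTemp ∧
      D.GtpYdd.map Γ.toMulEquiv.toMonoidHom = D.GtpYdd)
    (R : RigidData.{0} M l) (hR : R = C.rigidData (τ.mod M) hC hS h15 L)
    (hcoll : ∀ γ : R.PiX ≃ₜ* R.PiX, R.PiY.map γ.toMulEquiv.toMonoidHom = R.PiY →
      ∃ ψ : R.mu ≃* R.mu, ∀ (η : R.PiYdd → R.mu), η ∈ R.thetaCocycles →
        ∃ (η'' : R.PiYdd → R.mu) (_ : η'' ∈ R.thetaCocycles) (c : R.G → R.mu)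
          (hc : CycEnvelope.IsEnvCocycle R.augY R.chi (c ∘ R.augY))
          (_ : CycEnvelope.shift hc ∈ contMulAut R.env),
          ∀ d d' : R.PiYdd, γ (d : R.PiX) = d' → ψ (η d) = η'' d' * c (R.augY (R.inclYdd d'))) :
    R.Cor218_iv_surjective := by
  subst hR
  refine C.rigidData_cor218_iv_surjective_of_core τ M hC hS h15 h15ii L _ rfl (fun γ _ => ?_) hcoll
  obtain ⟨Γ, hΓ, hΔ, hYdd⟩ := hext γ
  exact ⟨C.map_subgroupOf_Huu_eq_of_extends γ Γ hΓ _ hYdd,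
    C.rigidData_augKer_map_eq_of_extends (τ.mod M) hC hS h15 L γ Γ hΓ hΔ,
    C.rigidData_thetaKer_map_eq_of_extends (τ.mod M) hC hS h15 L γ Γ hΓ hΔ,
    C.rigidData_lDeltaTheta_map_eq_of_extends (τ.mod M) hC hS h15 L γ Γ hΓ hΔ⟩

/-- **Necessity at the §1 model**: conversely, whenever Cor 2.18 (iv), surjectivity, holds for the §1
model at level `N` (for instance from the route of record), every `Π^tp_Y̲̲`-preserving automorphism of
`Π^tp_X̲̲` preserves `Π^tp_Ÿ̲̲ := Π^tp_Ÿ ∩ Π^tp_X̲̲` and the cyclotomic character on `Π^tp_Y̲̲`.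
[cite: MochizukiEtTh2009, Cor 2.18(iv) p.61] -/
theorem rigidData_necessary_of_cor218_iv_surjective {N : ℕ+} (μ : D.CyclotomeMod l N) (hC : D.Compat)
    (hS : D.Sec2Hyps) (h15 : Prop15iii E hC) (L : C.CuspLabels)
    (h : (C.rigidData μ hC hS h15 L).Cor218_iv_surjective)
    (γ : (C.rigidData μ hC hS h15 L).PiX ≃ₜ* (C.rigidData μ hC hS h15 L).PiX)
    (hγ : (C.rigidData μ hC hS h15 L).PiY.map γ.toMulEquiv.toMonoidHom = (C.rigidData μ hC hS h15 L).PiY) :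
    (C.rigidData μ hC hS h15 L).PiYdd.map γ.toMulEquiv.toMonoidHom = (C.rigidData μ hC hS h15 L).PiYdd ∧
      ∀ g : (C.rigidData μ hC hS h15 L).PiY,
        (C.rigidData μ hC hS h15 L).chi ((C.rigidData μ hC hS h15 L).aug (γ g)) =
          (C.rigidData μ hC hS h15 L).chi ((C.rigidData μ hC hS h15 L).aug g) :=
  ⟨(C.rigidData μ hC hS h15 L).map_PiYdd_eq_of_cor218_iv_surjective h γ hγ,
    (C.rigidData μ hC hS h15 L).chi_aug_invariant_PiY_of_cor218_iv_surjective h γ hγ⟩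

end ThetaSetting.EtaleThetaData.DoubleUnderline

end Literature.AnabelianGeometry.EtaleTheta

end
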